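import Literature.Analysis.FluidPDE.TaoAveragedCascade
import HarnessLib

/-!
# Tao's averaged Navier–Stokes blow-up: complex averaging (Def. 3.4) and the reduction of Theorem 3.2

T. Tao, *Finite time blowup for an averaged three-dimensional Navier–Stokes equation*,
J. Amer. Math. Soc. **29** (2016), 601–674 = arXiv:1402.0290v3 (held as `paper:arxiv-1402.0290`;
all numbers are those of that text), §3.1, p. 15: Definition 3.4 (complex averaging) and the
"first step: complexification" of the proof of **Theorem 3.2** (local cascade operators are
averaged Euler operators; in-tree named fact
`Literature.Analysis.FluidPDE.Tao2016.localCascade_isAveraged`, file `TaoAveragedCascade.lean`).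

Theorem 3.2 is proved in the source in nine steps (§3.1–§3.9, pp. 15–20). This file is the first
layer of its decomposition into named facts, with the glue between them proved:

* `IsComplexSymbol` — Tao's class `𝓜₀ ⊗ ℂ` of complex Fourier multipliers of order `0` (p. 6);
* `ComplexAveragingDatum`, `ComplexAveragingDatum.average`, `IsComplexAverageOf` — **Definition 3.4**
  (complex average of a bilinear operator `C'`);
* `complexAverage_isAveraged` — **§3.1** as a named fact: a complex average of the Euler operator
  `B` that is real on real fields is an averaged Euler bilinear operator (1.12)–(1.13);
* `localCascade_isComplexAverage` — **§3.2–§3.9** as a named fact: for `ε₀` below an absolute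
  threshold every local cascade operator is a complex average of `B` (the sentence closing §3.1:
  "Thus, it will suffice to show that every local cascade operator is a complex average of the
  Euler bilinear operator `B`");
* `complexAverage_linear_right` — the `ℂ`-linearity in `w` of a complex average
  `⟨C(u,v), w⟩ = ∫_Ω ⟨B(…u, …v), …w⟩ dμ` on `H¹⁰_df ⊗ ℂ` (absolute convergence of (1.12)/(3.4), p. 7
  and (3.5)), and `memH10dfC_decomposition` — `H¹⁰_df ⊗ ℂ = H¹⁰_df ⊕ i H¹⁰_df`; these two carry the
  identity of Theorem 3.2 from real test fields `w ∈ H¹⁰_df` (as printed) to the complexified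
  class `w ∈ H¹⁰_df ⊗ ℂ` in which `localCascade_isAveraged` records it (see the module docstring of
  `TaoAveragedCascade.lean`: "the `ℂ`-linear extension in `w` of the printed identity");
* `localCascade_isAveraged_of_complexAverage` — **Theorem 3.2 from the four facts**, proved, together
  with the realness of cascade forms on real fields (`basicCascadeForm_im`), the embedding of
  averaging data into complex averaging data (`AveragingDatum.toComplex`) and the non-vacuity of
  Definition 3.4 (`isComplexAverageOf_eulerForm_self`: `B` is a complex average of itself).

## Design notes

* **Operators by duality.** As in `TaoAveragedSobolev.lean` / `TaoAveragedCascade.lean`, a bilinear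
  operator `H¹⁰_df ⊗ ℂ × H¹⁰_df ⊗ ℂ → (H¹⁰_df)* ⊗ ℂ` *is* its trilinear duality form
  `L2C → L2C → L2C → ℂ`, and (3.4) is an identity of forms on arguments in `H¹⁰_df ⊗ ℂ`
  (`MemH10dfC`); the complex pairing is bilinear, "we do not place a complex conjugate on the `v`
  factor" (p. 15) — this is the tree's `pairing`.
* **Measurability.** Definition 3.4 asks `ω ↦ m_{i,ω}` to be measurable into the Fréchet space
  `𝓜₀ ⊗ ℂ`; exactly as the accepted `AveragingDatum` does for (1.13), `ComplexAveragingDatum`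
  records the implied pointwise measurability of `ω ↦ m_{i,ω}(ξ)` (`ξ ≠ 0`), of `ω ↦ R_{i,ω} x` and
  of `ω ↦ λ_{i,ω}`, so that an averaging datum *is* a complex averaging datum
  (`AveragingDatum.toComplex`, used in the assembly). This widens the class of complex averages;
  the two named facts that consume a complex average (`complexAverage_isAveraged`,
  `complexAverage_linear_right`) remain true under it — their printed proofs (§3.1; p. 7) use only
  the absolute convergence of (3.4), which follows from (3.5), the `λ`-bounds and joint
  measurability of Carathéodory integrands — and the fact that produces one
  (`localCascade_isComplexAverage`) is implied by the printed one.
* **Finite measure spaces** (Def. 3.4) versus probability spaces ((1.13)): `IsFiniteMeasure`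
  versus `IsProbabilityMeasure`; the normalisation is part of §3.1.

## What is not here

The discharge of the four named facts. `memH10dfC_decomposition`, `complexAverage_linear_right`
and `complexAverage_isAveraged` need the conjugation symmetry `𝓕(ū)(ξ) = conj 𝓕u(−ξ)` of
Mathlib's `L²` Fourier transform (by Schwartz density), `H¹⁰` bounds for multipliers, rotations
and dilations, and the absolute convergence of (1.3) on `H¹⁰`; `localCascade_isComplexAverage` is
§3.2–§3.9 (frequency localisation by imaginary-order multipliers, single-scale reduction, symbol
extraction, rotation averaging over `SO(3)³` via the implicit function theorem, Fourier inversion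
on `(ℝ/2πℤ)³` and the non-degeneracy (3.24)), to be decomposed further.

## References

* T. Tao, J. Amer. Math. Soc. 29 (2016), 601–674, arXiv:1402.0290v3: §1.1 pp. 6–7 ((1.10)–(1.13)),
  §3.1 p. 15 (Def. 3.4, (3.4)–(3.5)), §3.2–3.9 pp. 15–20, Thm. 3.2. Key `Tao2016AveragedNS`.
-/

noncomputable section

open MeasureTheory Set Filter
open scoped ENNReal NNReal SchwartzMap ComplexConjugate

namespace Literature.Analysis.FluidPDE.Tao2016

/-- Local notation for physical / frequency space `ℝ³`. -/
local notation "ℝ³" => EuclideanSpace ℝ (Fin 3)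
/-- Local notation for the complexified range `ℂ³`. -/
local notation "ℂ³" => EuclideanSpace ℂ (Fin 3)

/-! ### Complex Fourier multipliers of order `0` (`𝓜₀ ⊗ ℂ`) -/

/-- The symbols of **complex Fourier multipliers of order `0`**, Tao's class `𝓜₀ ⊗ ℂ` (2016,
p. 6): `m : ℝ³ → ℂ` smooth away from the origin with all seminorms `‖m‖_k` (1.10) finite — the
class `IsRealSymbol` without the reality condition `m(-ξ) = \overline{m(ξ)}` ("every complex
Fourier multiplier `m(D)` of order `0` can be uniquely decomposed as `m(D) = m₁(D) + i m₂(D)` with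
`m₁(D), m₂(D)` real Fourier multipliers of order `0`", p. 6). [cite: Tao2016AveragedNS, §1.1 p. 6] -/
def IsComplexSymbol (m : ℝ³ → ℂ) : Prop :=
  ContDiffOn ℝ ((⊤ : ℕ∞) : WithTop ℕ∞) m {0}ᶜ ∧ ∀ k, symbolSeminorm k m < ∞

/-- `𝓜₀ ⊆ 𝓜₀ ⊗ ℂ`: a real order-`0` symbol is a complex one. [cite: Tao2016AveragedNS, §1.1 p. 6] -/
theorem IsRealSymbol.isComplexSymbol {m : ℝ³ → ℂ} (hm : IsRealSymbol m) : IsComplexSymbol m :=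
  ⟨hm.1, hm.2.1⟩

/-- A complex order-`0` symbol is measurable and essentially bounded (by `‖m‖₀`), hence an `L^∞`
class acting boundedly on `L²` (same proof as `IsRealSymbol.memLp_top`, which does not use the
reality condition). [cite: Tao2016AveragedNS, §1.1 p. 6] -/
theorem IsComplexSymbol.memLp_top {m : ℝ³ → ℂ} (hm : IsComplexSymbol m) :
    MemLp m ∞ (volume : Measure ℝ³) := by
  obtain ⟨hsmooth, hsemi⟩ := hm
  have hmeas : Measurable m :=
    measurable_of_continuousOn_compl_singleton 0 hsmooth.continuousOn
  refine memLp_top_of_bound hmeas.aestronglyMeasurable (symbolSeminorm 0 m).toReal ?_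
  have h0 : ({0}ᶜ : Set ℝ³) ∈ ae (volume : Measure ℝ³) :=
    compl_mem_ae_iff.mpr (measure_singleton _)
  filter_upwards [h0] with ξ hξ
  have hle : (‖m ξ‖₊ : ℝ≥0∞) ≤ symbolSeminorm 0 m := by
    have : (‖m ξ‖₊ : ℝ≥0∞) = (‖ξ‖₊ : ℝ≥0∞) ^ 0 * ‖iteratedFDeriv ℝ 0 m ξ‖₊ := by
      rw [pow_zero, one_mul, ENNReal.coe_inj, ← NNReal.coe_inj, coe_nnnorm, coe_nnnorm,
        norm_iteratedFDeriv_zero]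
    rw [this]
    exact le_iSup₂ (f := fun (ξ : ℝ³) (_ : ξ ∈ ({0}ᶜ : Set ℝ³)) =>
      (‖ξ‖₊ : ℝ≥0∞) ^ 0 * (‖iteratedFDeriv ℝ 0 m ξ‖₊ : ℝ≥0∞)) ξ hξ
  calc ‖m ξ‖ = ((‖m ξ‖₊ : ℝ≥0∞)).toReal := by simp
    _ ≤ (symbolSeminorm 0 m).toReal := ENNReal.toReal_mono (hsemi 0).ne hle

/-- Constant complex symbols are complex order-`0` symbols (e.g. the factors `±1`, `i`,
`1/(-πi)` and the normalising constants that §3.1–§3.2 absorb into `m₁`). [cite: Tao2016AveragedNS, §3.1 p. 15] -/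
theorem isComplexSymbol_const (c : ℂ) : IsComplexSymbol (fun _ : ℝ³ => c) := by
  refine ⟨contDiffOn_const, fun k => ?_⟩
  rcases Nat.eq_zero_or_pos k with rfl | hk
  · refine lt_of_le_of_lt (iSup₂_le fun ξ _ => ?_) (ENNReal.coe_lt_top (r := ‖c‖₊))
    rw [pow_zero, one_mul, ENNReal.coe_le_coe, ← NNReal.coe_le_coe, coe_nnnorm, coe_nnnorm,
      norm_iteratedFDeriv_zero]
  · have h0 : ∀ ξ : ℝ³, iteratedFDeriv ℝ k (fun _ : ℝ³ => c) ξ = 0 := fun ξ => by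
      rw [iteratedFDeriv_const_of_ne hk.ne']
      rfl
    simp [symbolSeminorm, h0]

/-! ### Definition 3.4: complex averaging -/

/-- **The data of a complex average** (Tao 2016, Definition 3.4): a *finite* measure space
`(Ω, μ)`; for each slot `i : Fin 3` a random complex Fourier symbol of order `0`
`m i θ ∈ 𝓜₀ ⊗ ℂ`, a random rotation `R i θ ∈ SO(3)` and a random dilation factor `lam i θ` with
`C₀⁻¹ ≤ λᵢ ≤ C₀` for some finite `C₀`, subject to the **integrability conditions (3.5)**
`∫_Ω ‖m₁‖_{k₁} ‖m₂‖_{k₂} ‖m₃‖_{k₃} dμ < ∞` for all `k₁ k₂ k₃`. Measurability of the random data is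
recorded pointwise, exactly as in the accepted `AveragingDatum` (see the module docstring); `Ω`
lives in `Type`, so that `∃ 𝒟 : ComplexAveragingDatum, …` is a small proposition. The only
differences with `AveragingDatum` ((1.13)) are: complex symbols, finite (not probability)
measure. [cite: Tao2016AveragedNS, Def. 3.4] -/
structure ComplexAveragingDatum where
  /-- The sample space `Ω`. -/
  Ω : Type
  /-- Its σ-algebra. -/
  [mΩ : MeasurableSpace Ω]
  /-- The finite measure `μ`. -/
  μ : Measure Ω
  [isFinite : IsFiniteMeasure μ]
  /-- The three random complex symbols `m_{i,ω}`. -/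
  m : Fin 3 → Ω → ℝ³ → ℂ
  /-- The three random rotations `R_{i,ω}`. -/
  R : Fin 3 → Ω → (ℝ³ ≃ₗᵢ[ℝ] ℝ³)
  /-- The three random dilation factors `λ_{i,ω}`. -/
  lam : Fin 3 → Ω → ℝ
  /-- Each `m_{i,ω}` is a complex Fourier multiplier of order `0`. -/
  isComplexSymbol : ∀ i θ, IsComplexSymbol (m i θ)
  /-- Each `R_{i,ω}` is a rotation (`SO(3)`). -/
  det_R : ∀ i θ, LinearMap.det ((R i θ).toLinearEquiv : ℝ³ →ₗ[ℝ] ℝ³) = 1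
  /-- Dilation factors are positive … -/
  lam_pos : ∀ i θ, 0 < lam i θ
  /-- … and bounded above and below: `C₀⁻¹ ≤ λ_{i,ω} ≤ C₀`. -/
  lam_bdd : ∃ C : ℝ, ∀ i θ, C⁻¹ ≤ lam i θ ∧ lam i θ ≤ C
  /-- The integrability conditions (3.5). -/
  moment : ∀ k₁ k₂ k₃ : ℕ,
    ∫⁻ θ, symbolSeminorm k₁ (m 0 θ) * symbolSeminorm k₂ (m 1 θ) * symbolSeminorm k₃ (m 2 θ) ∂μ < ∞
  /-- Measurability of the random symbols (off the origin), … -/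
  measurable_m : ∀ i ξ, ξ ≠ 0 → Measurable fun θ => m i θ ξ
  /-- … rotations, … -/
  measurable_R : ∀ i x, Measurable fun θ => R i θ x
  /-- … and dilation factors. -/
  measurable_lam : ∀ i, Measurable (lam i)

attribute [instance] ComplexAveragingDatum.mΩ ComplexAveragingDatum.isFinite

namespace ComplexAveragingDatum

variable (𝒟 : ComplexAveragingDatum)

/-- The symbol of slot `i` at the sample `θ`, as an `L^∞` class. [cite: Tao2016AveragedNS, Def. 3.4] -/
def symbolLp (i : Fin 3) (θ : 𝒟.Ω) : Lp ℂ ∞ (volume : Measure ℝ³) :=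
  ((𝒟.isComplexSymbol i θ).memLp_top).toLp _

/-- The random operator of slot `i`, `m_{i,ω}(D) ∘ Rot_{R_{i,ω}} ∘ Dil_{λ_{i,ω}}` of (3.4)
(dilate, rotate, then apply the multiplier; same composition as `AveragingDatum.slot`). [cite: Tao2016AveragedNS, Def. 3.4 (3.4)] -/
def slot (i : Fin 3) (θ : 𝒟.Ω) (u : L2C) : L2C :=
  fourierMultiplier (𝒟.symbolLp i θ) (rot (𝒟.R i θ) (dil (𝒟.lam i θ) u))

/-- **The complex average of the form `C'` over the datum `𝒟`**, the right-hand side of (3.4):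
`∫_Ω ⟨C'(m_{1,ω}(D) Rot_{R_{1,ω}} Dil_{λ_{1,ω}} u, m_{2,ω}(D) Rot_{R_{2,ω}} Dil_{λ_{2,ω}} v), m_{3,ω}(D) Rot_{R_{3,ω}} Dil_{λ_{3,ω}} w⟩ dμ(ω)`
(Bochner integral; junk `0` where not integrable — for `C' = B` and arguments in `H¹⁰_df ⊗ ℂ` it
converges absolutely by (3.5), p. 7). [cite: Tao2016AveragedNS, Def. 3.4 (3.4)] -/
def average (C' : L2C → L2C → L2C → ℂ) (u v w : L2C) : ℂ :=
  ∫ θ, C' (𝒟.slot 0 θ u) (𝒟.slot 1 θ v) (𝒟.slot 2 θ w) ∂𝒟.μ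

end ComplexAveragingDatum

/-- **Definition 3.4 (Complex averaging)**, Tao 2016: the form `C = ⟨C(·,·), ·⟩` of a bilinear
operator `H¹⁰_df ⊗ ℂ × H¹⁰_df ⊗ ℂ → (H¹⁰_df)* ⊗ ℂ` **is a complex average of** `C'` if there is a
complex averaging datum `𝒟` (finite measure space, complex order-`0` symbols, rotations in
`SO(3)`, dilations in `[C₀⁻¹, C₀]`, integrability conditions (3.5)) such that (3.4)
`⟨C(u,v), w⟩ = ∫_Ω ⟨C'(m_{1,ω}(D) Rot Dil u, m_{2,ω}(D) Rot Dil v), m_{3,ω}(D) Rot Dil w⟩ dμ(ω)`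
holds for all `u, v, w ∈ H¹⁰_df ⊗ ℂ` (`MemH10dfC`). [cite: Tao2016AveragedNS, Def. 3.4] -/
def IsComplexAverageOf (C C' : L2C → L2C → L2C → ℂ) : Prop :=
  ∃ 𝒟 : ComplexAveragingDatum, ∀ u v w, MemH10dfC u → MemH10dfC v → MemH10dfC w →
    C u v w = 𝒟.average C' u v w

/-! ### Averaging data are complex averaging data -/

namespace AveragingDatum

variable (𝒜 : AveragingDatum)

/-- An averaging datum (1.13) is a complex averaging datum (Def. 3.4): real symbols are complex
symbols and a probability measure is finite. [cite: Tao2016AveragedNS, Def. 3.4] -/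
def toComplex : ComplexAveragingDatum where
  Ω := 𝒜.Ω
  μ := 𝒜.μ
  m := 𝒜.m
  R := 𝒜.R
  lam := 𝒜.lam
  isComplexSymbol i θ := (𝒜.isRealSymbol i θ).isComplexSymbol
  det_R := 𝒜.det_R
  lam_pos := 𝒜.lam_pos
  lam_bdd := 𝒜.lam_bdd
  moment := 𝒜.moment
  measurable_m := 𝒜.measurable_m
  measurable_R := 𝒜.measurable_R
  measurable_lam := 𝒜.measurable_lam

/-- The slots of `𝒜.toComplex` are those of `𝒜`. [folklore] -/
theorem toComplex_slot (i : Fin 3) (θ : 𝒜.Ω) (u : L2C) : 𝒜.toComplex.slot i θ u = 𝒜.slot i θ u :=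
  rfl

/-- The complex average of `C'` over `𝒜.toComplex` is the `𝒜`-expectation of `C'` of the slots. [folklore] -/
theorem toComplex_average (C' : L2C → L2C → L2C → ℂ) (u v w : L2C) :
    𝒜.toComplex.average C' u v w =
      ∫ θ, C' (𝒜.slot 0 θ u) (𝒜.slot 1 θ v) (𝒜.slot 2 θ w) ∂𝒜.μ :=
  rfl

/-- The complex average of `B` over `𝒜.toComplex` is the averaged Euler form `⟨B̃_𝒜(u,v), w⟩`
((1.13) is the case of (3.4) with real symbols and a probability measure). [cite: Tao2016AveragedNS, Def. 3.4] -/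
theorem toComplex_average_eulerForm (u v w : L2C) :
    𝒜.toComplex.average eulerForm u v w = 𝒜.form u v w :=
  rfl

/-- Every averaged Euler form is a complex average of the Euler form `B`. [cite: Tao2016AveragedNS, Def. 3.4] -/
theorem isComplexAverageOf_form : IsComplexAverageOf 𝒜.form eulerForm :=
  ⟨𝒜.toComplex, fun _ _ _ _ _ _ => rfl⟩

end AveragingDatum

/-- Complex averaging data exist (the Euler datum). [folklore] -/
instance : Inhabited ComplexAveragingDatum := ⟨AveragingDatum.euler.toComplex⟩

/-- **Non-vacuity of Definition 3.4**: the Euler bilinear operator `B` is a complex average of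
itself (the deterministic datum `mᵢ ≡ 1`, `Rᵢ = id`, `λᵢ = 1`). [folklore] -/
theorem isComplexAverageOf_eulerForm_self : IsComplexAverageOf eulerForm eulerForm :=
  ⟨AveragingDatum.euler.toComplex, fun u v w _ _ _ => by
    rw [AveragingDatum.toComplex_average_eulerForm, AveragingDatum.euler_form]⟩

/-! ### Realness of pairings and cascade forms on real fields -/

/-- A complex number with vanishing imaginary part is the cast of its real part. [folklore] -/
theorem eq_ofReal_re_of_im_eq_zero {z : ℂ} (hz : z.im = 0) : z = ((z.re : ℝ) : ℂ) :=
  Complex.ext (by simp) (by simp [hz])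

/-- An integral of an a.e. real integrand is real. [folklore] -/
theorem integral_im_eq_zero_of_ae_eq_ofReal {f : ℝ³ → ℂ} {g : ℝ³ → ℝ}
    (h : f =ᵐ[volume] fun x => ((g x : ℝ) : ℂ)) : (∫ x, f x).im = 0 := by
  rw [integral_congr_ae h, integral_complex_ofReal, Complex.ofReal_im]

/-- The pairing `⟨u, w⟩ = ∫ u · w` of two real fields is real ("as are the inner products on the
right-hand side", Tao p. 15). [cite: Tao2016AveragedNS, §3.1 p. 15] -/
theorem pairing_im {u w : L2C} (hu : IsReal u) (hw : IsReal w) : (pairing u w).im = 0 := by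
  refine integral_im_eq_zero_of_ae_eq_ofReal
    (g := fun x => ∑ i, ((u : ℝ³ → ℂ³) x i).re * ((w : ℝ³ → ℂ³) x i).re) ?_
  filter_upwards [hu, hw] with x hux hwx
  simp only [cdot, Complex.ofReal_sum, Complex.ofReal_mul]
  refine Finset.sum_congr rfl fun i _ => ?_
  rw [← eq_ofReal_re_of_im_eq_zero (hux i), ← eq_ofReal_re_of_im_eq_zero (hwx i)]

/-- A real Schwartz field, viewed in `L²(ℝ³; ℂ³)`, is real. [folklore] -/
theorem isReal_schwartzL2 (ψ : 𝓢(ℝ³, ℝ³)) : IsReal (schwartzL2 ψ) := by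
  unfold IsReal schwartzL2
  filter_upwards [MemLp.coeFn_toLp (memLp_complexify_comp ψ)] with x hx
  intro i
  rw [hx, Function.comp_apply, FunctionSpaces.EuclideanSpace.complexify_apply, Complex.ofReal_im]

/-- Dilations preserve realness. [folklore] -/
theorem isReal_dil {u : L2C} (hu : IsReal u) (c : ℝ) : IsReal (dil c u) := by
  unfold dil
  split_ifs with hc
  · exact hu
  · have hq : Measure.QuasiMeasurePreserving (fun x : ℝ³ => c • x) volume volume :=
      Measure.quasiMeasurePreserving_smul volume hc
    unfold IsReal
    filter_upwards [Lp.coeFn_smul (((c ^ (3 / 2 : ℝ) : ℝ) : ℂ)) ((memLp_comp_smul hc u).toLp _),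
      MemLp.coeFn_toLp (memLp_comp_smul hc u), hq.ae hu] with x h1 h2 h3
    intro i
    rw [h1, Pi.smul_apply, h2, PiLp.smul_apply, smul_eq_mul, Complex.mul_im, Complex.ofReal_im,
      Complex.ofReal_re, h3 i, mul_zero, zero_mul, add_zero]

/-- The cascade wavelets `ψₙ = Dil_{(1+ε₀)ⁿ} ψ` of real profiles are real fields. [folklore] -/
theorem isReal_cascadeWavelet (ε₀ : ℝ) (ψ : 𝓢(ℝ³, ℝ³)) (n : ℤ) :
    IsReal (cascadeWavelet ε₀ ψ n) :=
  isReal_dil (isReal_schwartzL2 ψ) _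

/-- **A basic local cascade form is real on real fields**: every term
`(1+ε₀)^{5n/2} ⟨u, ψ_{1,n}⟩ ⟨v, ψ_{2,n}⟩ ⟨w, ψ_{3,n}⟩` of (3.1) is real ("the left-hand side of
(3.4) is real (as are the inner products on the right-hand side)", Tao p. 15). [cite: Tao2016AveragedNS, §3.1 p. 15] -/
theorem basicCascadeForm_im (ε₀ : ℝ) (ψ₁ ψ₂ ψ₃ : 𝓢(ℝ³, ℝ³)) {u v w : L2C} (hu : IsReal u)
    (hv : IsReal v) (hw : IsReal w) : (basicCascadeForm ε₀ ψ₁ ψ₂ ψ₃ u v w).im = 0 := by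
  have h : ∀ n : ℤ, (((1 + ε₀) ^ ((5 : ℝ) * (n : ℝ) / 2) : ℝ) : ℂ) *
      (pairing u (cascadeWavelet ε₀ ψ₁ n) * pairing v (cascadeWavelet ε₀ ψ₂ n) *
        pairing w (cascadeWavelet ε₀ ψ₃ n)) =
      (((1 + ε₀) ^ ((5 : ℝ) * (n : ℝ) / 2) *
        ((pairing u (cascadeWavelet ε₀ ψ₁ n)).re * (pairing v (cascadeWavelet ε₀ ψ₂ n)).re *
          (pairing w (cascadeWavelet ε₀ ψ₃ n)).re) : ℝ) : ℂ) := by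
    intro n
    conv_lhs =>
      rw [eq_ofReal_re_of_im_eq_zero (pairing_im hu (isReal_cascadeWavelet ε₀ ψ₁ n)),
        eq_ofReal_re_of_im_eq_zero (pairing_im hv (isReal_cascadeWavelet ε₀ ψ₂ n)),
        eq_ofReal_re_of_im_eq_zero (pairing_im hw (isReal_cascadeWavelet ε₀ ψ₃ n))]
    push_cast
    ring
  unfold basicCascadeForm
  rw [tsum_congr h, ← Complex.ofReal_tsum, Complex.ofReal_im]

/-- A (real) local cascade combination `∑ⱼ cⱼ ⟨Cⱼ(u,v), w⟩` is real on real fields. [cite: Tao2016AveragedNS, §3.1 p. 15] -/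
theorem cascadeCombination_im (ε₀ : ℝ) {k : ℕ} (c : Fin k → ℝ)
    (ψ : Fin k → Fin 3 → 𝓢(ℝ³, ℝ³)) {u v w : L2C} (hu : IsReal u) (hv : IsReal v)
    (hw : IsReal w) :
    (∑ j, (c j : ℂ) * basicCascadeForm ε₀ (ψ j 0) (ψ j 1) (ψ j 2) u v w).im = 0 := by
  rw [Complex.im_sum]
  refine Finset.sum_eq_zero fun j _ => ?_
  rw [Complex.mul_im, Complex.ofReal_im, Complex.ofReal_re, basicCascadeForm_im ε₀ _ _ _ hu hv hw,
    mul_zero, zero_mul, add_zero]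

/-! ### The named facts -/

/-- **`H¹⁰_df ⊗ ℂ = H¹⁰_df ⊕ i H¹⁰_df`** (the meaning of the complexification `H¹⁰_df(ℝ³) ⊗ ℂ` on
which Tao's complexified operators act, pp. 6 and 15): every `w` with finite `H¹⁰` norm and
`ξ · ŵ(ξ) = 0` a.e. is `w₁ + i w₂` with `w₁ = Re w`, `w₂ = Im w` real, of finite `H¹⁰` norm and
divergence free (`ŵ₁(ξ) = (ŵ(ξ) + \overline{ŵ(-ξ)})/2`, by the conjugation symmetry
`𝓕(ū)(ξ) = \overline{𝓕u(-ξ)}` of the `L²` Fourier transform). A `Prop`-valued definition, not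
asserted (its discharge needs that symmetry for Mathlib's `Lp.fourierTransformₗᵢ`). [cite: Tao2016AveragedNS, §3.1 Def. 3.4] -/
def memH10dfC_decomposition : Prop :=
  ∀ w : L2C, MemH10dfC w →
    ∃ w₁ w₂ : L2C, MemH10df w₁ ∧ MemH10df w₂ ∧ w = w₁ + (Complex.I : ℂ) • w₂

/-- **A complex average of `B` is `ℂ`-linear in `w` on `H¹⁰_df ⊗ ℂ`** (Tao 2016, Def. 3.4: `C`,
`C'` are "bounded (complex-)bilinear operators" and (3.4) holds for all
`u, v, w ∈ H¹⁰_df ⊗ ℂ`; p. 7: "the expectation in (1.12) (or the integral in (1.13)) is absolutely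
convergent for any `u, v, w ∈ H¹⁰_df`", by the multiplier bounds, the `λ`-bounds and the moment /
integrability conditions (3.5)): for every complex averaging datum `𝒟` and `u, v ∈ H¹⁰_df ⊗ ℂ`,
`w ↦ ∫_Ω ⟨B(m₁(D) Rot Dil u, m₂(D) Rot Dil v), m₃(D) Rot Dil w⟩ dμ` is `ℂ`-linear on `H¹⁰_df ⊗ ℂ`
(the slots are linear operators on `L²`, the Euler form (1.3) converges absolutely on `H¹⁰`
arguments, and the `Ω`-integrands are integrable). In particular (via `AveragingDatum.toComplex`)
`w ↦ ⟨B̃_𝒜(u,v), w⟩` is `ℂ`-linear on `H¹⁰_df ⊗ ℂ`. A `Prop`-valued definition, not asserted. [cite: Tao2016AveragedNS, §1.1 p. 7 and Def. 3.4 (3.5)] -/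
def complexAverage_linear_right : Prop :=
  ∀ (𝒟 : ComplexAveragingDatum) (u v w₁ w₂ : L2C) (a b : ℂ),
    MemH10dfC u → MemH10dfC v → MemH10dfC w₁ → MemH10dfC w₂ →
      𝒟.average eulerForm u v (a • w₁ + b • w₂) =
        a * 𝒟.average eulerForm u v w₁ + b * 𝒟.average eulerForm u v w₂

/-- **Tao 2016, §3.1 (First step: complexification)**, the argument as printed, stated for the
forms it applies to: *if the form `T = ⟨C(·,·), ·⟩` is a complex average (Def. 3.4) of the Euler
bilinear operator `B`, and `⟨C(u,v), w⟩` is real for real `u, v, w ∈ H¹⁰_df`, then `C` is an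
averaged Euler bilinear operator (1.12)–(1.13)*: there is an averaging datum `𝒜` (probability
space, **real** symbols) with `⟨B̃_𝒜(u,v), w⟩ = ⟨C(u,v), w⟩` for all `u, v, w ∈ H¹⁰_df`. Printed
proof (p. 15): decompose each `m_{j,ω} = m_{j,ω,1} + i m_{j,ω,2}` into real multipliers, expand
(3.4) into `2³ = 8` pieces, "as the left-hand side of (3.4) is real (as are the inner products on
the right-hand side), we may eliminate all the terms on the right-hand side involving odd powers
of `i` by taking real parts", absorb the signs into `m_{1,ω}`, concatenate four copies of
`(Ω, μ)`, and normalise `μ` to a probability measure by scaling `m_{1,ω}`. A `Prop`-valued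
definition, not asserted. [cite: Tao2016AveragedNS, §3.1 p. 15] -/
def complexAverage_isAveraged : Prop :=
  ∀ T : L2C → L2C → L2C → ℂ, IsComplexAverageOf T eulerForm →
    (∀ u v w, MemH10df u → MemH10df v → MemH10df w → (T u v w).im = 0) →
      ∃ 𝒜 : AveragingDatum, ∀ u v w, MemH10df u → MemH10df v → MemH10df w →
        𝒜.form u v w = T u v w

/-- **Tao 2016, §3.2–§3.9: every local cascade operator is a complex average of the Euler
bilinear operator** (the claim to which §3.1 reduces Theorem 3.2: "Thus, it will suffice to show
that every local cascade operator is a complex average of the Euler bilinear operator `B`",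
p. 15, proved in §3.2–§3.9, pp. 15–20, for `ε₀ > 0` "sufficiently small (e.g. `ε₀ = 10⁻¹⁰` will
suffice)", with implied constants "not permitted to depend on `ε₀`", p. 15): there is an absolute
`ε₁ > 0` such that for every `0 < ε₀ ≤ ε₁` and every finite real linear combination
`∑ⱼ cⱼ Cⱼ` of basic local cascade operators (3.1) with dyadic scale parameter `ε₀` (profiles
Schwartz with Fourier support in the annulus `{1-2ε₀ ≤ |ξ| ≤ 1+2ε₀}`), the form
`∑ⱼ cⱼ ⟨Cⱼ(u,v), w⟩` — (3.1) read with the complex bilinear pairing for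
`u, v, w ∈ H¹⁰_df ⊗ ℂ`, as in (3.6) — is a complex average of `B` (Def. 3.4,
`IsComplexAverageOf`). Printed proof: closure of complex averages under finite linear
combinations and transitivity (§3.2), frequency localisation by the imaginary-order multipliers
`D^{it}` and `ρ(D)` (§3.3), reduction to a single frequency scale (§3.4), extraction of the symbol
by Plancherel (§3.5, (3.13)), simplification of the weights and rotation averaging over `SO(3)³`
(§3.6, (3.16)), rotations around fixed axes via the implicit function theorem (§3.7, (3.20)),
parametrisation by rotation angles (§3.8, (3.23)) and Fourier inversion on `(ℝ/2πℤ)³` under the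
non-degeneracy condition (3.24), verified for the normalisation (3.7) (§3.9). A `Prop`-valued
definition, not asserted. [cite: Tao2016AveragedNS, §3.2–3.9] -/
def localCascade_isComplexAverage : Prop :=
  ∃ ε₁ : ℝ, 0 < ε₁ ∧ ∀ ε₀ : ℝ, 0 < ε₀ → ε₀ ≤ ε₁ →
    ∀ (k : ℕ) (c : Fin k → ℝ) (ψ : Fin k → Fin 3 → 𝓢(ℝ³, ℝ³)),
      (∀ j i, HasAnnularFourierSupport ε₀ (ψ j i)) →
        IsComplexAverageOf
          (fun u v w => ∑ j, (c j : ℂ) * basicCascadeForm ε₀ (ψ j 0) (ψ j 1) (ψ j 2) u v w)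
          eulerForm

/-! ### Theorem 3.2 from the named facts -/

/-- `ℂ`-linearity in `w` of the averaged Euler form `⟨B̃_𝒜(u,v), w⟩` on `H¹⁰_df ⊗ ℂ`, from
`complexAverage_linear_right` through `AveragingDatum.toComplex`. [cite: Tao2016AveragedNS, §1.1 p. 7] -/
theorem AveragingDatum.form_linear_right (hlin : complexAverage_linear_right) (𝒜 : AveragingDatum)
    {u v w₁ w₂ : L2C} (a b : ℂ) (hu : MemH10dfC u) (hv : MemH10dfC v) (hw₁ : MemH10dfC w₁)
    (hw₂ : MemH10dfC w₂) :
    𝒜.form u v (a • w₁ + b • w₂) = a * 𝒜.form u v w₁ + b * 𝒜.form u v w₂ := by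
  simpa only [AveragingDatum.toComplex_average_eulerForm] using
    hlin 𝒜.toComplex u v w₁ w₂ a b hu hv hw₁ hw₂

/-- **Theorem 3.2 from its first-layer decomposition** (Tao 2016, §3.1: "Combining all these
manipulations, we conclude Theorem 3.2. Thus, it will suffice to show that every local cascade
operator is a complex average of the Euler bilinear operator `B`."). Given a local cascade form
`T` with parameter `ε₀ ≤ ε₁` (the threshold of `localCascade_isComplexAverage`), write
`T = S := ∑ⱼ cⱼ ⟨Cⱼ(·,·), ·⟩` on `H¹⁰_df × H¹⁰_df × (H¹⁰_df ⊗ ℂ)` (Def. 3.1); `S` is a complex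
average of `B` (§3.2–3.9) and is real on real fields (`cascadeCombination_im`), so §3.1 gives an
averaging datum `𝒜` with `⟨B̃_𝒜(u,v), w⟩ = S(u,v,w)` for real `u, v, w ∈ H¹⁰_df`; for
`w = w₁ + i w₂ ∈ H¹⁰_df ⊗ ℂ` (`memH10dfC_decomposition`) both sides are `ℂ`-linear in `w`
(`complexAverage_linear_right`, applied to `𝒜.toComplex` and to the complex datum of `S`), whence
the identity on `H¹⁰_df × H¹⁰_df × (H¹⁰_df ⊗ ℂ)` recorded by `localCascade_isAveraged`. [cite: Tao2016AveragedNS, Thm. 3.2 and §3.1 p. 15] -/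
theorem localCascade_isAveraged_of_complexAverage (hdec : memH10dfC_decomposition)
    (hlin : complexAverage_linear_right) (h31 : complexAverage_isAveraged)
    (h32 : localCascade_isComplexAverage) : localCascade_isAveraged := by
  obtain ⟨ε₁, hε₁, h32⟩ := h32
  refine ⟨ε₁, hε₁, fun ε₀ hε₀ hε₀₁ T hT => ?_⟩
  obtain ⟨k, c, ψ, hψ, hT⟩ := hT
  set S : L2C → L2C → L2C → ℂ := fun u v w =>
    ∑ j, (c j : ℂ) * basicCascadeForm ε₀ (ψ j 0) (ψ j 1) (ψ j 2) u v w with hS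
  have hSavg : IsComplexAverageOf S eulerForm := h32 ε₀ hε₀ hε₀₁ k c ψ hψ
  have hSreal : ∀ u v w, MemH10df u → MemH10df v → MemH10df w → (S u v w).im = 0 :=
    fun u v w hu hv hw => cascadeCombination_im ε₀ c ψ hu.2.1 hv.2.1 hw.2.1
  obtain ⟨𝒜, h𝒜⟩ := h31 S hSavg hSreal
  obtain ⟨𝒟, h𝒟⟩ := hSavg
  refine ⟨𝒜, fun u v w hu hv hw => ?_⟩
  obtain ⟨w₁, w₂, hw₁, hw₂, rfl⟩ := hdec w hw
  rw [hT u v _ hu hv hw]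
  change 𝒜.form u v (w₁ + Complex.I • w₂) = S u v (w₁ + Complex.I • w₂)
  have e1 : 𝒜.form u v (w₁ + Complex.I • w₂) =
      𝒜.form u v w₁ + Complex.I * 𝒜.form u v w₂ := by
    have := AveragingDatum.form_linear_right hlin 𝒜 1 Complex.I hu.memH10dfC hv.memH10dfC
      hw₁.memH10dfC hw₂.memH10dfC
    rwa [one_smul, one_mul] at this
  have e2 : S u v (w₁ + Complex.I • w₂) = S u v w₁ + Complex.I * S u v w₂ := by
    rw [h𝒟 u v _ hu.memH10dfC hv.memH10dfC hw, h𝒟 u v w₁ hu.memH10dfC hv.memH10dfC hw₁.memH10dfC,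
      h𝒟 u v w₂ hu.memH10dfC hv.memH10dfC hw₂.memH10dfC]
    have := hlin 𝒟 u v w₁ w₂ 1 Complex.I hu.memH10dfC hv.memH10dfC hw₁.memH10dfC hw₂.memH10dfC
    rwa [one_smul, one_mul] at this
  rw [e1, e2, h𝒜 u v w₁ hu hv hw₁, h𝒜 u v w₂ hu hv hw₂]

end Literature.Analysis.FluidPDE.Tao2016
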